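import Mathlib
import Summits.NavierStokesRegularity.NavierStokesRegularity.Theorems.PoloidalWindowDoorPoloidalWindowRigidityZShockRotatingShear

/-!
# Crux K2 `PoloidalWindowRigidity` (stmt-NavierStokesRegularity-19708), line `z_shock` — the QUADRATIC-IN-THE-PLANE sector of the autonomous
# height-evolution with quadratic `G`: rigid by the same finite-height blow-up (trace Liouville), again with NO boundedness

`--supports stmt-NavierStokesRegularity-19708 --as helper` (leafhand-ns-poloidalwindowdoor-3 g31, cell decomp-ns, 2026-09-01).  Class-free,
def-free; Mathlib + the same hand's `…ZShockRotatingShear` (ODE Liouville `superquadratic_entire_eq_zero`).  **No stub and no summit is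
closed by this file; Navier–Stokes regularity is NOT proved here (rung 0).**

THE SECTOR.  Height-evolution `w_zz + Δₕ[G(w)] = 0` of the deciding stub (K-48; slope `g = G'`, type `g(w)|∇ₕw|² ≤ 0`), now with `w` a
QUADRATIC polynomial on every horizontal plane with height-dependent coefficients and the simplest genuinely nonlinear slope, `g` AFFINE
(`g(s) = κs + g₀`, `κ ≠ 0`, i.e. `G` cubic-free quadratic-slope: `G'' ≡ κ`):

  `w = ½s₁₁(z)x² + s₁₂(z)xy + ½s₂₂(z)y² + p₁(z)x + p₂(z)y + c(z)`,   `∇ₕw = (s₁₁x + s₁₂y + p₁, s₁₂x + s₂₂y + p₂)`,   `Δₕw = s₁₁ + s₂₂`.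

Then `Δₕ[G(w)] = ∂ₓ(g(w)∂ₓw) + ∂_y(g(w)∂_yw) = κ|∇ₕw|² + g(w)Δₕw` (dictionary `hasDerivAt_flux_x/y`), so PDE and type clause read, at every point,

  (P₂) `½s₁₁''x² + s₁₂''xy + ½s₂₂''y² + p₁''x + p₂''y + c'' + κ|∇ₕw|² + (κw + g₀)(s₁₁ + s₂₂) = 0`,     (T₂) `(κw + g₀)|∇ₕw|² ≤ 0`.

The degree-one case `S ≡ 0` is the rotating-shear sector of `…ZShockRotatingShear` (rigid there).  RESULT:
* ★ `quadraticSector_rigid` — (P₂) ∧ (T₂) everywhere, `κ ≠ 0` ⇒ `s₁₁ ≡ s₁₂ ≡ s₂₂ ≡ 0`.  Proof: the `x²`- and `y²`-coefficients of (P₂)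
  (second differences at `x = 0,1,2`) give `½s₁₁'' = −κ(s₁₁² + s₁₂²) − ½κ(trS)s₁₁` and the `y`-analogue, so the signed trace
  `τ := −κ·trS` satisfies **`τ'' = 2κ²(s₁₁² + 2s₁₂² + s₂₂²) + τ² ≥ τ²`**; (T₂) along the lines `(t,0)` / `(0,t)` with `t → ∞` gives
  `κs₁₁ ≤ 0`, `κs₂₂ ≤ 0`, i.e. `τ ≥ 0`; the ODE Liouville of `…ZShockRotatingShear` (`q ≥ 0`, `q'' ≥ q²` on `ℝ` ⇒ `q ≡ 0`) forces `τ ≡ 0`,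
  hence `τ'' ≡ 0` and `s₁₁² + 2s₁₂² + s₂₂² ≡ 0`.  No boundedness of `w` is used (the inhabitants excluded here grow quadratically anyway).
Census reading (crux 19708, `hGN` of `…ZShockAutOfSliceLiouville`): the finite-height gradient catastrophe of the line's thesis is visible in
closed form one polynomial degree further: with a quadratic slope law, EVERY entire pattern that is polynomial of degree ≤ 2 on horizontal
planes and has no strictly elliptic point is horizontally linear, hence (by `rotatingShear_rigid`) untwisted or not genuinely nonlinear.  The
mechanism is a TRACE identity (`τ'' − τ² = 2κ²·tr S² ≥ 0`), suggesting the invariant to monitor on the general autonomous column is a signed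
horizontal Laplacian of `G(w)` rather than a Riemann invariant.  Honest scope: kinematic, scalar level, one ansatz sector with affine slope;
`hGN` / R3 stay XL, not in print. [folklore]
-/

namespace Summit.NavierStokesRegularity.NavierStokesRegularity.Theorems.PoloidalWindowDoorPoloidalWindowRigidityZShockRotatingShearQuadratic

-- the summit and its single sub-problem share the name (CONVENTIONS §1)
set_option linter.dupNamespace false

open Summit.NavierStokesRegularity.NavierStokesRegularity.Theorems.PoloidalWindowDoorPoloidalWindowRigidityZShockRotatingShear

/-! ## Dictionary: the horizontal flux derivatives -/

/-- Dictionary (`x`-flux): with `∂ₓw = s₁₁x + s₁₂y + p₁` and affine slope `g(s) = κs + g₀`,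
`∂ₓ( g(w)·∂ₓw ) = κ(∂ₓw)² + g(w)·s₁₁`. [folklore] -/
theorem hasDerivAt_flux_x (s₁₁ s₁₂ s₂₂ p₁ p₂ c κ g₀ x y : ℝ) :
    HasDerivAt (fun x => (κ * (s₁₁ * x ^ 2 / 2 + s₁₂ * x * y + s₂₂ * y ^ 2 / 2 + p₁ * x + p₂ * y + c) + g₀) * (s₁₁ * x + s₁₂ * y + p₁))
      (κ * (s₁₁ * x + s₁₂ * y + p₁) ^ 2 +
        (κ * (s₁₁ * x ^ 2 / 2 + s₁₂ * x * y + s₂₂ * y ^ 2 / 2 + p₁ * x + p₂ * y + c) + g₀) * s₁₁) x := by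
  have hx : HasDerivAt (fun x : ℝ => x) 1 x := hasDerivAt_id' x
  have hx2 : HasDerivAt (fun x : ℝ => x ^ 2) (2 * x) x := by simpa using hasDerivAt_pow 2 x
  have hw : HasDerivAt (fun x => s₁₁ * x ^ 2 / 2 + s₁₂ * x * y + s₂₂ * y ^ 2 / 2 + p₁ * x + p₂ * y + c)
      (s₁₁ * (2 * x) / 2 + s₁₂ * 1 * y + 0 + p₁ * 1 + 0 + 0) x :=
    ((((((hx2.const_mul s₁₁).div_const 2).fun_add ((hx.const_mul s₁₂).mul_const y)).fun_add (hasDerivAt_const x _)).fun_add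
      (hx.const_mul p₁)).fun_add (hasDerivAt_const x _)).fun_add (hasDerivAt_const x _)
  have hg : HasDerivAt (fun x => κ * (s₁₁ * x ^ 2 / 2 + s₁₂ * x * y + s₂₂ * y ^ 2 / 2 + p₁ * x + p₂ * y + c) + g₀)
      (κ * (s₁₁ * (2 * x) / 2 + s₁₂ * 1 * y + 0 + p₁ * 1 + 0 + 0) + 0) x := (hw.const_mul κ).fun_add (hasDerivAt_const x _)
  have hdw : HasDerivAt (fun x => s₁₁ * x + s₁₂ * y + p₁) (s₁₁ * 1 + 0 + 0) x :=
    ((hx.const_mul s₁₁).fun_add (hasDerivAt_const x _)).fun_add (hasDerivAt_const x _)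
  exact (hg.fun_mul hdw).congr_deriv (by ring)

/-- Dictionary (`y`-flux): `∂_y( g(w)·∂_yw ) = κ(∂_yw)² + g(w)·s₂₂`; adding the `x`-flux, `Δₕ[G(w)] = κ|∇ₕw|² + g(w)(s₁₁ + s₂₂)` — the last
two groups of terms of (P₂). [folklore] -/
theorem hasDerivAt_flux_y (s₁₁ s₁₂ s₂₂ p₁ p₂ c κ g₀ x y : ℝ) :
    HasDerivAt (fun y => (κ * (s₁₁ * x ^ 2 / 2 + s₁₂ * x * y + s₂₂ * y ^ 2 / 2 + p₁ * x + p₂ * y + c) + g₀) * (s₁₂ * x + s₂₂ * y + p₂))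
      (κ * (s₁₂ * x + s₂₂ * y + p₂) ^ 2 +
        (κ * (s₁₁ * x ^ 2 / 2 + s₁₂ * x * y + s₂₂ * y ^ 2 / 2 + p₁ * x + p₂ * y + c) + g₀) * s₂₂) y := by
  have hy : HasDerivAt (fun y : ℝ => y) 1 y := hasDerivAt_id' y
  have hy2 : HasDerivAt (fun y : ℝ => y ^ 2) (2 * y) y := by simpa using hasDerivAt_pow 2 y
  have hw : HasDerivAt (fun y => s₁₁ * x ^ 2 / 2 + s₁₂ * x * y + s₂₂ * y ^ 2 / 2 + p₁ * x + p₂ * y + c)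
      (0 + s₁₂ * x * 1 + s₂₂ * (2 * y) / 2 + 0 + p₂ * 1 + 0) y :=
    ((((((hasDerivAt_const y _).fun_add (hy.const_mul (s₁₂ * x))).fun_add ((hy2.const_mul s₂₂).div_const 2)).fun_add
      (hasDerivAt_const y _)).fun_add (hy.const_mul p₂)).fun_add (hasDerivAt_const y _))
  have hg : HasDerivAt (fun y => κ * (s₁₁ * x ^ 2 / 2 + s₁₂ * x * y + s₂₂ * y ^ 2 / 2 + p₁ * x + p₂ * y + c) + g₀)
      (κ * (0 + s₁₂ * x * 1 + s₂₂ * (2 * y) / 2 + 0 + p₂ * 1 + 0) + 0) y := (hw.const_mul κ).fun_add (hasDerivAt_const y _)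
  have hdw : HasDerivAt (fun y => s₁₂ * x + s₂₂ * y + p₂) (0 + s₂₂ * 1 + 0) y :=
    (((hasDerivAt_const y _).fun_add (hy.const_mul s₂₂))).fun_add (hasDerivAt_const y _)
  exact (hg.fun_mul hdw).congr_deriv (by ring)

/-! ## Two elementary lemmas for the type clause along a line -/

/-- A quadratic with positive leading coefficient is eventually positive: for `t ≥ (|β| + |γ| + 1)/α + 1`, `αt² + βt + γ > 0`. [folklore] -/
theorem quadratic_pos_of_large {α β γ t : ℝ} (hα : 0 < α) (ht : (|β| + |γ| + 1) / α + 1 ≤ t) : 0 < α * t ^ 2 + β * t + γ := by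
  have h1 : 1 ≤ t := by
    have : 0 ≤ (|β| + |γ| + 1) / α := by positivity
    linarith
  have h2 : |β| + |γ| + 1 ≤ α * t := by
    have : (|β| + |γ| + 1) / α ≤ t := by linarith
    rwa [div_le_iff₀ hα, mul_comm] at this
  have hβ : -|β| * t ≤ β * t := by nlinarith [neg_abs_le β]
  have hγ : -|γ| ≤ γ := neg_abs_le γ
  nlinarith [abs_nonneg β, abs_nonneg γ]

/-- (T₂) along a coordinate line forces the sign of the diagonal entry: if for all `t` the product
`(αt² + βt + γ)·((σt + π)² + ρ(t))` is `≤ 0` with `ρ ≥ 0` and `σ ≠ 0`, then `α ≤ 0`. [folklore] -/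
theorem leading_nonpos_of_type {α β γ σ π : ℝ} {ρ : ℝ → ℝ} (hσ : σ ≠ 0) (hρ : ∀ t, 0 ≤ ρ t)
    (hT : ∀ t, (α * t ^ 2 + β * t + γ) * ((σ * t + π) ^ 2 + ρ t) ≤ 0) : α ≤ 0 := by
  by_contra hα
  push Not at hα
  set T := (|β| + |γ| + 1) / α + 1 with hT_def
  -- one of `T`, `T + 1` is not the root of `σt + π`
  obtain ⟨t, ht, hne⟩ : ∃ t, T ≤ t ∧ σ * t + π ≠ 0 := by
    by_cases h : σ * T + π = 0
    · refine ⟨T + 1, by linarith, ?_⟩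
      intro h'
      apply hσ
      linarith
    · exact ⟨T, le_rfl, h⟩
  have hq : 0 < α * t ^ 2 + β * t + γ := quadratic_pos_of_large hα ht
  have hsq : 0 < (σ * t + π) ^ 2 + ρ t := by linarith [sq_pos_iff.mpr hne, hρ t]
  linarith [hT t, mul_pos hq hsq]

/-! ## Rigidity of the quadratic sector -/

/-- ★ **The quadratic-in-the-plane sector with affine slope is rigid (trace Liouville).**  Let `s₁₁, s₂₂` be `C²` on `ℝ` (derivatives
`s₁₁₁, s₁₁₂`, `s₂₂₁, s₂₂₂`), `s₁₂, p₁, p₂, c` and the second height-derivatives `s₁₂₂, p₁₂, p₂₂, c₂` arbitrary functions, `κ ≠ 0`, `g₀ ∈ ℝ`.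
If (P₂) and (T₂) of the module docstring hold at EVERY point, the quadratic part vanishes identically: `s₁₁ ≡ s₁₂ ≡ s₂₂ ≡ 0` (`w` is affine
on every plane — the rotating-shear sector, rigid by `…ZShockRotatingShear.rotatingShear_rigid`).  Mechanism: `τ = −κ(s₁₁ + s₂₂) ≥ 0`
satisfies `τ'' = 2κ²(s₁₁² + 2s₁₂² + s₂₂²) + τ² ≥ τ²` on the whole line. [folklore] -/
theorem quadraticSector_rigid {s₁₁ s₁₁₁ s₁₁₂ s₂₂ s₂₂₁ s₂₂₂ : ℝ → ℝ} (s₁₂ s₁₂₂ p₁ p₁₂ p₂ p₂₂ c c₂ : ℝ → ℝ) {κ : ℝ} (g₀ : ℝ)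
    (hκ : κ ≠ 0)
    (h₁₁ : ∀ z, HasDerivAt s₁₁ (s₁₁₁ z) z) (h₁₁' : ∀ z, HasDerivAt s₁₁₁ (s₁₁₂ z) z)
    (h₂₂ : ∀ z, HasDerivAt s₂₂ (s₂₂₁ z) z) (h₂₂' : ∀ z, HasDerivAt s₂₂₁ (s₂₂₂ z) z)
    (hP : ∀ x y z,
      s₁₁₂ z * x ^ 2 / 2 + s₁₂₂ z * x * y + s₂₂₂ z * y ^ 2 / 2 + p₁₂ z * x + p₂₂ z * y + c₂ z +
        κ * ((s₁₁ z * x + s₁₂ z * y + p₁ z) ^ 2 + (s₁₂ z * x + s₂₂ z * y + p₂ z) ^ 2) +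
        (κ * (s₁₁ z * x ^ 2 / 2 + s₁₂ z * x * y + s₂₂ z * y ^ 2 / 2 + p₁ z * x + p₂ z * y + c z) + g₀) * (s₁₁ z + s₂₂ z) = 0)
    (hT : ∀ x y z,
      (κ * (s₁₁ z * x ^ 2 / 2 + s₁₂ z * x * y + s₂₂ z * y ^ 2 / 2 + p₁ z * x + p₂ z * y + c z) + g₀) *
        ((s₁₁ z * x + s₁₂ z * y + p₁ z) ^ 2 + (s₁₂ z * x + s₂₂ z * y + p₂ z) ^ 2) ≤ 0) :
    ∀ z, s₁₁ z = 0 ∧ s₁₂ z = 0 ∧ s₂₂ z = 0 := by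
  -- the `x²`- and `y²`-coefficients of (P₂), by second differences at `0, 1, 2`
  have hA : ∀ z, s₁₁₂ z = -κ * (2 * (s₁₁ z ^ 2 + s₁₂ z ^ 2) + (s₁₁ z + s₂₂ z) * s₁₁ z) := by
    intro z
    have h0 := hP 0 0 z
    have h1 := hP 1 0 z
    have h2 := hP 2 0 z
    linear_combination h2 - 2 * h1 + h0
  have hB : ∀ z, s₂₂₂ z = -κ * (2 * (s₁₂ z ^ 2 + s₂₂ z ^ 2) + (s₁₁ z + s₂₂ z) * s₂₂ z) := by
    intro z
    have h0 := hP 0 0 z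
    have h1 := hP 0 1 z
    have h2 := hP 0 2 z
    linear_combination h2 - 2 * h1 + h0
  -- signs of the diagonal entries from (T₂) along the coordinate lines
  have hdiag₁ : ∀ z, κ * s₁₁ z ≤ 0 := by
    intro z
    by_cases hs : s₁₁ z = 0
    · simp [hs]
    have h2 : κ * s₁₁ z / 2 ≤ 0 := by
      refine leading_nonpos_of_type (β := κ * p₁ z) (γ := κ * c z + g₀) (σ := s₁₁ z) (π := p₁ z)
        (ρ := fun t => (s₁₂ z * t + p₂ z) ^ 2) hs (fun t => sq_nonneg _) ?_
      intro t
      have h := hT t 0 z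
      have e1 : κ * (s₁₁ z * t ^ 2 / 2 + s₁₂ z * t * 0 + s₂₂ z * 0 ^ 2 / 2 + p₁ z * t + p₂ z * 0 + c z) + g₀
          = κ * s₁₁ z / 2 * t ^ 2 + κ * p₁ z * t + (κ * c z + g₀) := by ring
      have e2 : (s₁₁ z * t + s₁₂ z * 0 + p₁ z) ^ 2 + (s₁₂ z * t + s₂₂ z * 0 + p₂ z) ^ 2
          = (s₁₁ z * t + p₁ z) ^ 2 + (s₁₂ z * t + p₂ z) ^ 2 := by ring
      rw [e1, e2] at h
      exact h
    linarith
  have hdiag₂ : ∀ z, κ * s₂₂ z ≤ 0 := by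
    intro z
    by_cases hs : s₂₂ z = 0
    · simp [hs]
    have h2 : κ * s₂₂ z / 2 ≤ 0 := by
      refine leading_nonpos_of_type (β := κ * p₂ z) (γ := κ * c z + g₀) (σ := s₂₂ z) (π := p₂ z)
        (ρ := fun t => (s₁₂ z * t + p₁ z) ^ 2) hs (fun t => sq_nonneg _) ?_
      intro t
      have h := hT 0 t z
      have e1 : κ * (s₁₁ z * 0 ^ 2 / 2 + s₁₂ z * 0 * t + s₂₂ z * t ^ 2 / 2 + p₁ z * 0 + p₂ z * t + c z) + g₀
          = κ * s₂₂ z / 2 * t ^ 2 + κ * p₂ z * t + (κ * c z + g₀) := by ring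
      have e2 : (s₁₁ z * 0 + s₁₂ z * t + p₁ z) ^ 2 + (s₁₂ z * 0 + s₂₂ z * t + p₂ z) ^ 2
          = (s₂₂ z * t + p₂ z) ^ 2 + (s₁₂ z * t + p₁ z) ^ 2 := by ring
      rw [e1, e2] at h
      exact h
    linarith
  -- the signed trace `τ = −κ tr S ≥ 0` obeys `τ'' = 2κ² tr S² + τ² ≥ τ²` on the whole line
  have hτ : ∀ z, HasDerivAt (fun t => -κ * (s₁₁ t + s₂₂ t)) (-κ * (s₁₁₁ z + s₂₂₁ z)) z :=
    fun z => ((h₁₁ z).fun_add (h₂₂ z)).const_mul (-κ)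
  have hτ₁ : ∀ z, HasDerivAt (fun t => -κ * (s₁₁₁ t + s₂₂₁ t)) (-κ * (s₁₁₂ z + s₂₂₂ z)) z :=
    fun z => ((h₁₁' z).fun_add (h₂₂' z)).const_mul (-κ)
  have hτ₂ : ∀ z, -κ * (s₁₁₂ z + s₂₂₂ z)
      = 2 * κ ^ 2 * (s₁₁ z ^ 2 + 2 * s₁₂ z ^ 2 + s₂₂ z ^ 2) + (-κ * (s₁₁ z + s₂₂ z)) ^ 2 := by
    intro z
    rw [hA z, hB z]
    ring
  have hineq : ∀ z, 1 * (-κ * (s₁₁ z + s₂₂ z)) ^ 2 ≤ -κ * (s₁₁₂ z + s₂₂₂ z) := by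
    intro z
    rw [hτ₂ z]
    nlinarith [sq_nonneg (s₁₁ z), sq_nonneg (s₁₂ z), sq_nonneg (s₂₂ z), sq_nonneg κ]
  have hnn : ∀ z, 0 ≤ -κ * (s₁₁ z + s₂₂ z) := fun z => by nlinarith [hdiag₁ z, hdiag₂ z]
  have hzero : ∀ z, -κ * (s₁₁ z + s₂₂ z) = 0 := superquadratic_entire_eq_zero (k := 1) one_pos hτ hτ₁ hineq hnn
  -- hence `τ' ≡ 0`, `τ'' ≡ 0`, and `tr S² ≡ 0`
  have hτ₁zero : ∀ z, -κ * (s₁₁₁ z + s₂₂₁ z) = 0 := by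
    intro z
    have hconst : (fun t => -κ * (s₁₁ t + s₂₂ t)) = fun _ => (0 : ℝ) := funext hzero
    have h := (hτ z).deriv
    rw [hconst, deriv_const] at h
    exact h.symm
  have hτ₂zero : ∀ z, -κ * (s₁₁₂ z + s₂₂₂ z) = 0 := by
    intro z
    have hconst : (fun t => -κ * (s₁₁₁ t + s₂₂₁ t)) = fun _ => (0 : ℝ) := funext hτ₁zero
    have h := (hτ₁ z).deriv
    rw [hconst, deriv_const] at h
    exact h.symm
  intro z
  have hsum : 2 * κ ^ 2 * (s₁₁ z ^ 2 + 2 * s₁₂ z ^ 2 + s₂₂ z ^ 2) = 0 := by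
    have h := hτ₂ z
    rw [hτ₂zero z, hzero z] at h
    linarith
  have hκ2 : 0 < κ ^ 2 := by positivity
  have hS : s₁₁ z ^ 2 + 2 * s₁₂ z ^ 2 + s₂₂ z ^ 2 = 0 := by nlinarith
  refine ⟨?_, ?_, ?_⟩ <;> nlinarith [sq_nonneg (s₁₁ z), sq_nonneg (s₁₂ z), sq_nonneg (s₂₂ z)]

end Summit.NavierStokesRegularity.NavierStokesRegularity.Theorems.PoloidalWindowDoorPoloidalWindowRigidityZShockRotatingShearQuadratic
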